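import Literature.RepresentationTheory.KonnoKonno2007.JunctionPMinusFockSymbol
import Literature.RepresentationTheory.KonnoKonno2007.JunctionHyperbolicVacuumPin
import Literature.RepresentationTheory.KonnoKonno2007.JunctionDegreeOneKTypes
import HarnessLib

/-!
# `𝔭⁻` on an archimedean Weil datum: the conjugated boost and the annihilation of the printed vectors
  [cite: Folland1989, Prop (4.39)]

REPRODUCTION (Literature side), sequel of `JunctionPMinusFockSymbol`.  For a genuine archimedean Weil datum `ω` of the
real unitary dual pair `(U(P,Q), U(R,S))` (`IsArchWeilDatum (ι𝕎 P Q R S) ω`):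

* §0 (pure matrix algebra) the conjugated boost `κ k_P(θ) · (a_t, 1) · κ k_P(θ)⁻¹` (`k_P(θ) = phaseP θ` the `P`-side
  phase of part 1, `a_t = hypV t` theta-1's boost with matrix `plant [[cosh t, −i sinh t],[i sinh t, cosh t]]`) has first
  component `plant [[cosh t, −z i sinh t],[z̄ i sinh t, cosh t]]`, `z = e^{iθ}`, second component `1`; at `θ = π/2` it is
  the REAL boost `plant [[cosh t, sinh t],[sinh t, cosh t]]` (`coe_fst_κ_phaseP_conj_hypV_pi_div_two`) — the direction
  `i v` of the hyperbolic plane, i.e. the one-parameter group `exp (t · (e_{p₀} e_{q₀}ᵀ + e_{q₀} e_{p₀}ᵀ))`;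
* §1 `ω (κ k · g · κ k⁻¹) f = μ₀(ι k) (ω g (μ₀(ι k)⁻¹ f))` — (w2) along `κ` is `μ₀`-covariance (`isRhoCovariantS_comp_κ`),
  (w2′) + Schur give `ω (κ k) = c_k • μ₀(ι k)` and the vacuum characters cancel, `c_k c_{k⁻¹} = 1`;
* §2 `ω (κ k_P(θ) · (hypV t, 1) · κ k_P(θ)⁻¹) = rotBoostOp θ t` (theta-1's `weilDatum_apply_hypV_eq_hypOp` inside the
  conjugation), the slopes of `ω` along the boost and the conjugated boost exist in `𝓢` and are `hypOpGen`, `rotBoostGen θ`;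
* §3 for `S = ∅` the `𝔭⁻`-combination `D₁ + i D₂` of the two slopes VANISHES on every `B⁻¹F` with
  `∂_{(p₀,r)}∂_{(q₀,r)}F = 0` — the vacuum and all degree-one vectors in particular (the Cauchy–Riemann / lowest-weight
  relation `(X_v + iX_{iv}) φ = 0`, `X_v + iX_{iv}` the LOWER-LEFT block);
* §4 the same along EVERY `K`-conjugate: `κ k (a_t,1) κ k⁻¹ = (k_V a_t k_V⁻¹, 1)` is the boost in the direction
  `k_V e_{p₀}` and `κ (k k_P(π/2)) (a_t,1) κ (k k_P(π/2))⁻¹` the one in the direction `i k_V e_{p₀}`; `ω` of them is the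
  `μ₀(ι k)`-conjugate of `hypOp t` / `rotBoostOp (π/2) t`, the slopes (also with rescaled time `c t`) are the
  `μ₀(ι k)`-conjugates of `hypOpGen` / `rotBoostGen (π/2)`, and `D₁ + i D₂ = 0` persists on the vacuum and on every
  degree-one vector (`S = ∅`) — the relation in all directions `v = c · k_V e_{p₀}` of the hyperbolic planes
  through `e_{q₀}`; `weilDatum_pMinus_κ_conj_smul{,_degOne,_hermitePi_zero}` state it with REAL difference quotients
  `t⁻¹ • (ω(γ(ct)) f − f)`, the shape a consumer differentiating `t ↦ ω(exp (t v)) f` at `0` meets.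

## Provenance

LEAN-IN-TREE rule (2026-08-18), pub-hodgecm formalisation cell, model-construction sub-cell, seat mc-theta-2
gens 5–6, node «W6b-hol (REP)» (RULING (YY′) 2026-08-19; §4 for the (ASM) interface of RULINGS (DDD′)/(EEE′)).
Over `JunctionPMinusFockSymbol`, theta-1's `JunctionHyperbolicVacuumPin` and `JunctionDegreeOneKTypes`.  Kernel only,
no records.
-/

set_option autoImplicit false

noncomputable section

open Matrix Complex MeasureTheory Filter MvPolynomial
open scoped Topology Real BigOperators ComplexConjugate
open Literature.Analysis.SegalBargmann Literature.Analysis.Distribution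

local notation "SR" σ => SchwartzMap (σ → ℝ) ℂ

namespace Literature.RepresentationTheory.KonnoKonno2007

namespace RealDualPair

open Literature.NumberTheory.Weil1964 Literature.NumberTheory.Automorphic Literature.NumberTheory.Automorphic.UnitaryGroup

/-! ## §0  The conjugated boost `k_P(θ) · a_t · k_P(θ)⁻¹` as a matrix -/

section BoostMatrix

variable {P Q : Type*} [Fintype P] [DecidableEq P] [Fintype Q] [DecidableEq Q]
  (R S : Type*) [Fintype R] [DecidableEq R] [Fintype S] [DecidableEq S] (p₀ : P) (q₀ : Q)

/-- conjugating a planted `2 × 2` block by a diagonal matrix supported on the `P`-block re-weights the two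
off-diagonal entries: `diag(d, 1) · plant(m) · diag(e, 1) = plant [[m₀₀, d_{p₀} m₀₁], [e_{p₀} m₁₀, m₁₁]]`
whenever `d · e = 1` pointwise. [folklore] -/
theorem fromBlocks_diagonal_mul_plant_mul (d e : P → ℂ) (hde : ∀ p, d p * e p = 1)
    (m : Matrix (Fin 2) (Fin 2) ℂ) :
    Matrix.fromBlocks (Matrix.diagonal d) 0 0 (1 : Matrix Q Q ℂ) * plant p₀ q₀ m *
        Matrix.fromBlocks (Matrix.diagonal e) 0 0 (1 : Matrix Q Q ℂ) =
      plant p₀ q₀ !![m 0 0, d p₀ * m 0 1; e p₀ * m 1 0, m 1 1] := by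
  rw [← Matrix.diagonal_one, Matrix.fromBlocks_diagonal, Matrix.fromBlocks_diagonal]
  ext i j
  rw [Matrix.mul_diagonal, Matrix.diagonal_mul]
  rcases i with p | q <;> rcases j with p' | q'
  · simp only [Sum.elim_inl, plant_inl_inl, Matrix.of_apply, Matrix.cons_val_zero]
    split_ifs with h₁ h₂ h₃
    · subst h₁; subst h₂; rw [mul_right_comm, hde, one_mul]
    · rw [mul_zero, zero_mul]
    · subst h₃; rw [mul_one, hde]
    · rw [mul_zero, zero_mul]
  · simp only [Sum.elim_inl, Sum.elim_inr, plant_inl_inr, Matrix.of_apply, Matrix.cons_val_zero,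
      Matrix.cons_val_one, mul_one]
    split_ifs with h
    · obtain ⟨rfl, -⟩ := h; rfl
    · rw [mul_zero]
  · simp only [Sum.elim_inl, Sum.elim_inr, plant_inr_inl, Matrix.of_apply, Matrix.cons_val_zero,
      Matrix.cons_val_one, one_mul]
    split_ifs with h
    · obtain ⟨-, rfl⟩ := h; rw [mul_comm]
    · rw [zero_mul]
  · simp only [Sum.elim_inr, plant_inr_inr, Matrix.of_apply, Matrix.cons_val_zero, Matrix.cons_val_one,
      one_mul, mul_one]

/-- the inverse of a diagonal unitary `diagHom c` has matrix `diagonal (star c)`. [folklore] -/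
theorem coe_diagHom_inv (c : P → Circle) :
    (((diagHom c)⁻¹ : Matrix.unitaryGroup P ℂ) : Matrix P P ℂ) = Matrix.diagonal fun l => star ((c l : Circle) : ℂ) := by
  rw [← star_star (((diagHom c)⁻¹ : Matrix.unitaryGroup P ℂ) : Matrix P P ℂ), star_coe_inv_unitary, coe_diagHom',
    Matrix.star_eq_conjTranspose, Matrix.diagonal_conjTranspose]
  rfl

/-- **THE CONJUGATED BOOST AS A MATRIX**: the first component of `κ k_P(θ) · (a_t, 1) · κ k_P(θ)⁻¹` is
`plant [[cosh t, −z·i·sinh t], [z̄·i·sinh t, cosh t]]`, `z = e^{iθ}` — the boost `a_t` (direction `v`) rotated to the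
direction `z̄ v` of the hyperbolic plane. [folklore] -/
theorem coe_fst_κ_phaseP_conj_hypV (θ t : ℝ) :
    ((((κ P Q R S (phaseP R S p₀ θ) * (((hypV p₀ q₀ t : UForm P Q), (1 : UForm R S)) : Ginf P Q R S) *
        κ P Q R S (phaseP R S p₀ θ)⁻¹).1 : UForm P Q) : GL (P ⊕ Q) ℂ) : Matrix (P ⊕ Q) (P ⊕ Q) ℂ) =
      plant p₀ q₀ !![(Real.cosh t : ℂ), -(((Circle.exp θ : Circle) : ℂ) * I) * (Real.sinh t : ℂ);
        (star ((Circle.exp θ : Circle) : ℂ) * I) * (Real.sinh t : ℂ), (Real.cosh t : ℂ)] := by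
  rw [phaseP_eq]
  show (((UForm.kV P Q (diagHom (circleAt p₀ θ), 1) * hypV p₀ q₀ t *
      UForm.kV P Q ((diagHom (circleAt p₀ θ), (1 : Matrix.unitaryGroup Q ℂ))⁻¹) : UForm P Q) : GL (P ⊕ Q) ℂ) :
        Matrix (P ⊕ Q) (P ⊕ Q) ℂ) = _
  rw [Prod.inv_mk, inv_one, Subgroup.coe_mul, Subgroup.coe_mul, Units.val_mul, Units.val_mul, UForm.coe_kV,
    UForm.coe_kV, coe_hypV]
  dsimp only
  rw [coe_diagHom_inv, OneMemClass.coe_one, coe_diagHom',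
    fromBlocks_diagonal_mul_plant_mul p₀ q₀ _ _ (fun p => coe_circle_mul_star (circleAt p₀ θ p)) _]
  congr 1
  ext i j
  fin_cases i <;> fin_cases j <;> simp [circleAt, Function.update_self] <;> ring

/-- … and its second component is `1`. [folklore] -/
theorem snd_κ_phaseP_conj_hypV (θ t : ℝ) :
    (κ P Q R S (phaseP R S p₀ θ) * (((hypV p₀ q₀ t : UForm P Q), (1 : UForm R S)) : Ginf P Q R S) *
        κ P Q R S (phaseP R S p₀ θ)⁻¹).2 = 1 := by
  rw [phaseP_eq]
  show UForm.kV R S (1, 1) * 1 * UForm.kV R S (((1 : Matrix.unitaryGroup R ℂ), (1 : Matrix.unitaryGroup S ℂ))⁻¹) = 1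
  rw [Prod.mk_one_one, inv_one, map_one, mul_one, mul_one]

/-- **AT `θ = π/2` THE CONJUGATED BOOST IS THE REAL BOOST** `plant [[cosh t, sinh t], [sinh t, cosh t]]`
(= `exp (t·E)` with `E = e_{p₀} ⊗ e_{q₀}ᵀ + e_{q₀} ⊗ e_{p₀}ᵀ`, the direction `i v`). [folklore] -/
theorem coe_fst_κ_phaseP_conj_hypV_pi_div_two (t : ℝ) :
    ((((κ P Q R S (phaseP R S p₀ (π / 2)) * (((hypV p₀ q₀ t : UForm P Q), (1 : UForm R S)) : Ginf P Q R S) *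
        κ P Q R S (phaseP R S p₀ (π / 2))⁻¹).1 : UForm P Q) : GL (P ⊕ Q) ℂ) : Matrix (P ⊕ Q) (P ⊕ Q) ℂ) =
      plant p₀ q₀ !![(Real.cosh t : ℂ), (Real.sinh t : ℂ); (Real.sinh t : ℂ), (Real.cosh t : ℂ)] := by
  rw [coe_fst_κ_phaseP_conj_hypV R S p₀ q₀ (π / 2) t, coe_circleExp_pi_div_two, Complex.star_def, Complex.conj_I]
  congr 1
  ext i j
  fin_cases i <;> fin_cases j <;> simp

/-- entries of the real boost: `(inl p₀, inr q₀) ↦ sinh t`, `(inr q₀, inl p₀) ↦ sinh t`. [folklore] -/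
theorem κ_phaseP_conj_hypV_pi_div_two_inl_inr (t : ℝ) :
    ((((κ P Q R S (phaseP R S p₀ (π / 2)) * (((hypV p₀ q₀ t : UForm P Q), (1 : UForm R S)) : Ginf P Q R S) *
        κ P Q R S (phaseP R S p₀ (π / 2))⁻¹).1 : UForm P Q) : GL (P ⊕ Q) ℂ) : Matrix (P ⊕ Q) (P ⊕ Q) ℂ)
      (Sum.inl p₀) (Sum.inr q₀) = (Real.sinh t : ℂ) := by
  rw [coe_fst_κ_phaseP_conj_hypV_pi_div_two, plant_inl_inr, if_pos ⟨rfl, rfl⟩]; rfl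

end BoostMatrix

/-! ## §1–§3  Transport to an archimedean Weil datum -/

section Weil

variable {P Q : Type*} [Fintype P] [DecidableEq P] [Fintype Q] [DecidableEq Q]
  (R S : Type*) [Fintype R] [DecidableEq R] [Fintype S] [DecidableEq S] (p₀ : P) (q₀ : Q)

/-- **conjugation by the maximal compact is conjugation by `μ₀`**: for an archimedean Weil datum `ω`,
`ω (κ k · g · κ k⁻¹) f = μ₀(ι k) (ω g (μ₀(ι k)⁻¹ f))` — (w2) along `κ` is `μ₀`-covariance, (w2′) + Schur give
`ω (κ k) = c_k • μ₀(ι k)`, and `c_k c_{k⁻¹} = 1`. [cite: Folland1989, §4.2, the Schur remark p. 156; Prop. (4.39)] -/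
theorem weilDatum_apply_κ_mul_mul_κ_inv {ω : Representation ℂ (Ginf P Q R S) (SR (DPIdx P Q R S))}
    (hW : IsArchWeilDatum (ι𝕎 P Q R S) ω) (k : DPK P Q R S) (g : Ginf P Q R S) (f : SR (DPIdx P Q R S)) :
    ω (κ P Q R S k * g * κ P Q R S k⁻¹) f =
      unitaryOpPi (dualPairι k) (ω g (unitaryOpPi (dualPairι k)⁻¹ f)) := by
  have hS := isRhoCovariantS_comp_κ ω hW.covariant
  obtain ⟨U, hU⟩ := exists_liftFamily
    (A := fun k => (ω (κ P Q R S k) : (SR (DPIdx P Q R S)) →ₗ[ℂ] SR (DPIdx P Q R S)))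
    fun k => hW.exists_lift (κ P Q R S k)
  have happ : ∀ (k' : DPK P Q R S) (f' : SR (DPIdx P Q R S)),
      ω (κ P Q R S k') f' = vacCoeff U k' • unitaryOpPi (dualPairι k') f' := fun k' f' => by
    have h := hS.apply_eq_vacCoeff_smul_unitaryOpPi hU k' f'
    beta_reduce at h
    exact h
  have hcc : vacCoeff U k * vacCoeff U k⁻¹ = 1 := by
    have h1 : ω (κ P Q R S k) (ω (κ P Q R S k⁻¹) (hermitePi 0)) = hermitePi 0 := by
      rw [← Module.End.mul_apply, ← map_mul, ← map_mul, mul_inv_cancel, map_one, map_one, Module.End.one_apply]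
    rw [happ, happ, map_smul, smul_smul, map_inv, unitaryOpPi_mul_inv_apply] at h1
    exact smul_left_injective ℂ hermitePi_zero_ne_zero (h1.trans (one_smul ℂ _).symm)
  rw [map_mul, map_mul, Module.End.mul_apply, Module.End.mul_apply, happ, happ, map_smul, map_smul, smul_smul, hcc,
    one_smul, map_inv]

/-- the same with `(κ k)⁻¹`. [cite: Folland1989, §4.2, the Schur remark p. 156] -/
theorem weilDatum_apply_κ_mul_mul_inv_κ {ω : Representation ℂ (Ginf P Q R S) (SR (DPIdx P Q R S))}
    (hW : IsArchWeilDatum (ι𝕎 P Q R S) ω) (k : DPK P Q R S) (g : Ginf P Q R S) (f : SR (DPIdx P Q R S)) :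
    ω (κ P Q R S k * g * (κ P Q R S k)⁻¹) f =
      unitaryOpPi (dualPairι k) (ω g (unitaryOpPi (dualPairι k)⁻¹ f)) := by
  rw [← map_inv, weilDatum_apply_κ_mul_mul_κ_inv R S hW]

/-- **`ω` OF THE CONJUGATED BOOST IS `rotBoostOp θ t`**: `ω (κ k_P(θ) · (hypV t, 1) · κ k_P(θ)⁻¹) f = rotBoostOp θ t f`
(theta-1's `weilDatum_apply_hypV_eq_hypOp` inside the conjugation). [cite: Folland1989, Prop (4.39); (4.24)] -/
theorem weilDatum_apply_rotBoost {ω : Representation ℂ (Ginf P Q R S) (SR (DPIdx P Q R S))}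
    (hW : IsArchWeilDatum (ι𝕎 P Q R S) ω) (θ t : ℝ) (f : SR (DPIdx P Q R S)) :
    ω (κ P Q R S (phaseP R S p₀ θ) * (((hypV p₀ q₀ t : UForm P Q), (1 : UForm R S)) : Ginf P Q R S) *
        κ P Q R S (phaseP R S p₀ θ)⁻¹) f = rotBoostOp R S p₀ q₀ θ t f := by
  rw [weilDatum_apply_κ_mul_mul_κ_inv R S hW, weilDatum_apply_hypV_eq_hypOp hW, rotBoostOp_apply, phaseU_def]

/-- **slope of `ω` along the conjugated boost**: `((t:ℝ):ℂ)⁻¹ • (ω (κ k_P(θ) (hypV t, 1) κ k_P(θ)⁻¹) f − f) ⟶ rotBoostGen θ f`.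
[cite: Folland1989, (4.24)] -/
theorem weilDatum_tendsto_rotBoost_sub_div_ofReal {ω : Representation ℂ (Ginf P Q R S) (SR (DPIdx P Q R S))}
    (hW : IsArchWeilDatum (ι𝕎 P Q R S) ω) (θ : ℝ) (f : SR (DPIdx P Q R S)) :
    Tendsto (fun t : ℝ => ((t : ℝ) : ℂ)⁻¹ •
        (ω (κ P Q R S (phaseP R S p₀ θ) * (((hypV p₀ q₀ t : UForm P Q), (1 : UForm R S)) : Ginf P Q R S) *
          κ P Q R S (phaseP R S p₀ θ)⁻¹) f - f)) (𝓝[≠] 0)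
      (𝓝 (rotBoostGen R S p₀ q₀ θ f)) := by
  simp only [weilDatum_apply_rotBoost R S p₀ q₀ hW]
  exact tendsto_rotBoostOp_sub_div_ofReal R S p₀ q₀ θ f

/-- **THE `𝔭⁻`-ANNIHILATION FOR A WEIL DATUM, `S = ∅`**: for `φ = B⁻¹F` with `∂_{(p₀,r)}∂_{(q₀,r)}F = 0` the two slopes
`D₁ φ = lim t⁻¹ (ω(b_t) φ − φ)` (boost `b_t = (hypV t, 1)`) and `D₂ φ = lim t⁻¹ (ω(k b_t k⁻¹) φ − φ)` (`k = κ k_P(π/2)`,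
the boost in the direction `i v`) exist in `𝓢` and satisfy `D₁ φ + i D₂ φ = 0` — the Cauchy–Riemann / lowest-weight
relation `(X_v + iX_{iv}) φ = 0` of the printed vectors. [cite: Folland1989, Prop (4.39)] -/
theorem weilDatum_pMinus_binvPi [IsEmpty S] {ω : Representation ℂ (Ginf P Q R S) (SR (DPIdx P Q R S))}
    (hW : IsArchWeilDatum (ι𝕎 P Q R S) ω) (F : MvPolynomial (DPIdx P Q R S) ℂ)
    (hF : ∀ r : R, pderiv (Sum.inl (Sum.inl (p₀, r))) (pderiv (Sum.inr (Sum.inr (q₀, r))) F) = 0) :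
    Tendsto (fun t : ℝ => ((t : ℝ) : ℂ)⁻¹ •
        (ω (((hypV p₀ q₀ t : UForm P Q), (1 : UForm R S)) : Ginf P Q R S) (binvPi F) - binvPi F)) (𝓝[≠] 0)
      (𝓝 (hypOpGen R S p₀ q₀ (binvPi F))) ∧
    Tendsto (fun t : ℝ => ((t : ℝ) : ℂ)⁻¹ •
        (ω (κ P Q R S (phaseP R S p₀ (π / 2)) * (((hypV p₀ q₀ t : UForm P Q), (1 : UForm R S)) : Ginf P Q R S) *
          κ P Q R S (phaseP R S p₀ (π / 2))⁻¹) (binvPi F) - binvPi F)) (𝓝[≠] 0)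
      (𝓝 (rotBoostGen R S p₀ q₀ (π / 2) (binvPi F))) ∧
    hypOpGen R S p₀ q₀ (binvPi F) + I • rotBoostGen R S p₀ q₀ (π / 2) (binvPi F) = 0 :=
  ⟨weilDatum_tendsto_hypV_sub_div_ofReal hW p₀ q₀ _, weilDatum_tendsto_rotBoost_sub_div_ofReal R S p₀ q₀ hW _ _,
    hypOpGen_add_I_smul_rotBoostGen_binvPi_eq_zero R S p₀ q₀ F hF⟩

/-- the `𝔭⁻`-annihilation of every degree-one vector for a Weil datum (`S = ∅`). [cite: Folland1989, Prop (4.39)] -/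
theorem weilDatum_pMinus_degOne [IsEmpty S] {ω : Representation ℂ (Ginf P Q R S) (SR (DPIdx P Q R S))}
    (hW : IsArchWeilDatum (ι𝕎 P Q R S) ω) (a : DPIdx P Q R S → ℂ) :
    Tendsto (fun t : ℝ => ((t : ℝ) : ℂ)⁻¹ •
        (ω (((hypV p₀ q₀ t : UForm P Q), (1 : UForm R S)) : Ginf P Q R S) (degOne a) - degOne a)) (𝓝[≠] 0)
      (𝓝 (hypOpGen R S p₀ q₀ (degOne a))) ∧
    Tendsto (fun t : ℝ => ((t : ℝ) : ℂ)⁻¹ •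
        (ω (κ P Q R S (phaseP R S p₀ (π / 2)) * (((hypV p₀ q₀ t : UForm P Q), (1 : UForm R S)) : Ginf P Q R S) *
          κ P Q R S (phaseP R S p₀ (π / 2))⁻¹) (degOne a) - degOne a)) (𝓝[≠] 0)
      (𝓝 (rotBoostGen R S p₀ q₀ (π / 2) (degOne a))) ∧
    hypOpGen R S p₀ q₀ (degOne a : SR (DPIdx P Q R S)) + I • rotBoostGen R S p₀ q₀ (π / 2) (degOne a) = 0 :=
  ⟨weilDatum_tendsto_hypV_sub_div_ofReal hW p₀ q₀ _, weilDatum_tendsto_rotBoost_sub_div_ofReal R S p₀ q₀ hW _ _,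
    hypOpGen_add_I_smul_rotBoostGen_degOne R S p₀ q₀ a⟩

/-! ## §4  Every `K`-conjugate of the boost

For the consumer's `(X_v + iX_{iv}) φ_ℓ = 0` in ALL directions `v`: `Ad (κ k)` moves the boost `a_t` to the boost in the
direction `k_V e_{p₀}`, and `k · k_P(π/2)` to the direction `i k_V e_{p₀}`; on `𝓢` this is conjugation of the two
slopes by the unitary `μ₀(ι k)`, which preserves the relation `D₁ + i D₂ = 0`. -/

/-- a `K`-conjugate of `(g, 1)` is `(k_V g k_V⁻¹, 1)`. [folklore] -/
theorem κ_mul_inl_mul_κ_inv (k : DPK P Q R S) (g : UForm P Q) :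
    κ P Q R S k * ((g, (1 : UForm R S)) : Ginf P Q R S) * κ P Q R S k⁻¹ =
      ((UForm.kV P Q k.1 * g * (UForm.kV P Q k.1)⁻¹, (1 : UForm R S)) : Ginf P Q R S) := by
  rw [map_inv]
  refine Prod.ext ?_ ?_
  · rfl
  · show UForm.kV R S k.2 * 1 * (UForm.kV R S k.2)⁻¹ = 1
    rw [mul_one, mul_inv_cancel]

/-- time-rescaling of a slope at `0`: if `t⁻¹ • (γ t − f) ⟶ L` along `𝓝[≠] 0` and `γ 0 = f` then
`t⁻¹ • (γ (c t) − f) ⟶ c • L` for every real `c`. [folklore] -/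
theorem tendsto_inv_smul_sub_comp_mul {E : Type*} [AddCommGroup E] [Module ℂ E] [TopologicalSpace E]
    [ContinuousConstSMul ℂ E] {γ : ℝ → E} {f L : E}
    (hγ : Tendsto (fun t : ℝ => ((t : ℝ) : ℂ)⁻¹ • (γ t - f)) (𝓝[≠] 0) (𝓝 L)) (h0 : γ 0 = f) (c : ℝ) :
    Tendsto (fun t : ℝ => ((t : ℝ) : ℂ)⁻¹ • (γ (c * t) - f)) (𝓝[≠] 0) (𝓝 (((c : ℝ) : ℂ) • L)) := by
  rcases eq_or_ne c 0 with rfl | hc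
  · simp only [zero_mul, h0, sub_self, smul_zero, Complex.ofReal_zero, zero_smul]
    exact tendsto_const_nhds
  have hm : Tendsto (fun t : ℝ => c * t) (𝓝[≠] (0 : ℝ)) (𝓝[≠] 0) := by
    refine tendsto_nhdsWithin_of_tendsto_nhds_of_eventually_within _ ?_ ?_
    · exact ((continuous_const.mul continuous_id).tendsto' 0 0 (by simp)).mono_left nhdsWithin_le_nhds
    · exact eventually_nhdsWithin_of_forall fun t ht =>
        Set.mem_compl_singleton_iff.2 (mul_ne_zero hc (Set.mem_compl_singleton_iff.1 ht))
  have h := (hγ.comp hm).const_smul ((c : ℝ) : ℂ)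
  refine h.congr' (eventually_nhdsWithin_of_forall fun t _ => ?_)
  simp only [Function.comp_apply, smul_smul]
  rw [Complex.ofReal_mul, mul_inv, ← mul_assoc, mul_inv_cancel₀ (Complex.ofReal_ne_zero.2 hc), one_mul]

/-- at `t = 0` a `K`-conjugate boost is `1` and acts trivially (for ANY representation `ω`). [folklore] -/
theorem apply_κ_conj_hypV_zero (ω : Representation ℂ (Ginf P Q R S) (SR (DPIdx P Q R S))) (k : DPK P Q R S)
    (f : SR (DPIdx P Q R S)) :
    ω (κ P Q R S k * (((hypV p₀ q₀ 0 : UForm P Q), (1 : UForm R S)) : Ginf P Q R S) * κ P Q R S k⁻¹) f = f := by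
  rw [hypV_zero, Prod.mk_one_one, mul_one, ← map_mul, mul_inv_cancel, map_one, map_one, Module.End.one_apply]

/-- **`ω` OF A `K`-CONJUGATE BOOST**: `ω (κ k · (a_t, 1) · κ k⁻¹) f = μ₀(ι k) (hypOp t (μ₀(ι k)⁻¹ f))`.
[cite: Folland1989, Prop (4.39); (4.24)] -/
theorem weilDatum_apply_κ_conj_hypV {ω : Representation ℂ (Ginf P Q R S) (SR (DPIdx P Q R S))}
    (hW : IsArchWeilDatum (ι𝕎 P Q R S) ω) (k : DPK P Q R S) (t : ℝ) (f : SR (DPIdx P Q R S)) :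
    ω (κ P Q R S k * (((hypV p₀ q₀ t : UForm P Q), (1 : UForm R S)) : Ginf P Q R S) * κ P Q R S k⁻¹) f =
      unitaryOpPi (dualPairι k) (hypOp R S p₀ q₀ t (unitaryOpPi (dualPairι k)⁻¹ f)) := by
  rw [weilDatum_apply_κ_mul_mul_κ_inv R S hW, weilDatum_apply_hypV_eq_hypOp hW]

/-- **slope of `ω` along a `K`-conjugate boost**: `t⁻¹ • (ω (κ k (a_t, 1) κ k⁻¹) f − f) ⟶ μ₀(ι k) (hypOpGen (μ₀(ι k)⁻¹ f))`.
[cite: Folland1989, (4.24)] -/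
theorem weilDatum_tendsto_κ_conj_hypV_sub_div_ofReal {ω : Representation ℂ (Ginf P Q R S) (SR (DPIdx P Q R S))}
    (hW : IsArchWeilDatum (ι𝕎 P Q R S) ω) (k : DPK P Q R S) (f : SR (DPIdx P Q R S)) :
    Tendsto (fun t : ℝ => ((t : ℝ) : ℂ)⁻¹ •
        (ω (κ P Q R S k * (((hypV p₀ q₀ t : UForm P Q), (1 : UForm R S)) : Ginf P Q R S) * κ P Q R S k⁻¹) f - f))
      (𝓝[≠] 0) (𝓝 (unitaryOpPi (dualPairι k) (hypOpGen R S p₀ q₀ (unitaryOpPi (dualPairι k)⁻¹ f)))) := by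
  have hf : unitaryOpPi (dualPairι k) (unitaryOpPi (dualPairι k)⁻¹ f) = f := unitaryOpPi_mul_inv_apply _ f
  have h := ((unitaryOpPi (dualPairι k)).continuous.tendsto
    (hypOpGen R S p₀ q₀ (unitaryOpPi (dualPairι k)⁻¹ f))).comp
      (tendsto_hypOp_sub_div_ofReal R S p₀ q₀ (unitaryOpPi (dualPairι k)⁻¹ f))
  refine h.congr fun t => ?_
  simp only [Function.comp_apply, map_smul, map_sub, hf, weilDatum_apply_κ_conj_hypV R S p₀ q₀ hW]

/-- the same slope with the time rescaled by `c` (a boost of speed `c`). [cite: Folland1989, (4.24)] -/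
theorem weilDatum_tendsto_κ_conj_hypV_mul_sub_div_ofReal {ω : Representation ℂ (Ginf P Q R S) (SR (DPIdx P Q R S))}
    (hW : IsArchWeilDatum (ι𝕎 P Q R S) ω) (k : DPK P Q R S) (c : ℝ) (f : SR (DPIdx P Q R S)) :
    Tendsto (fun t : ℝ => ((t : ℝ) : ℂ)⁻¹ •
        (ω (κ P Q R S k * (((hypV p₀ q₀ (c * t) : UForm P Q), (1 : UForm R S)) : Ginf P Q R S) * κ P Q R S k⁻¹) f -
          f))
      (𝓝[≠] 0) (𝓝 (((c : ℝ) : ℂ) • unitaryOpPi (dualPairι k) (hypOpGen R S p₀ q₀ (unitaryOpPi (dualPairι k)⁻¹ f)))) :=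
  tendsto_inv_smul_sub_comp_mul
    (γ := fun s : ℝ => ω (κ P Q R S k * (((hypV p₀ q₀ s : UForm P Q), (1 : UForm R S)) : Ginf P Q R S) *
      κ P Q R S k⁻¹) f) (weilDatum_tendsto_κ_conj_hypV_sub_div_ofReal R S p₀ q₀ hW k f)
    (apply_κ_conj_hypV_zero R S p₀ q₀ ω k f) c

/-- **`ω` OF THE PARTNER** `κ (k·k_P(θ)) · (a_t, 1) · κ (k·k_P(θ))⁻¹` (the boost in the direction `e^{iθ} k_V e_{p₀}`):
`μ₀(ι k) (rotBoostOp θ t (μ₀(ι k)⁻¹ f))`. [cite: Folland1989, Prop (4.39); (4.24)] -/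
theorem weilDatum_apply_κ_mul_phaseP_conj_hypV {ω : Representation ℂ (Ginf P Q R S) (SR (DPIdx P Q R S))}
    (hW : IsArchWeilDatum (ι𝕎 P Q R S) ω) (k : DPK P Q R S) (θ t : ℝ) (f : SR (DPIdx P Q R S)) :
    ω (κ P Q R S (k * phaseP R S p₀ θ) * (((hypV p₀ q₀ t : UForm P Q), (1 : UForm R S)) : Ginf P Q R S) *
        κ P Q R S (k * phaseP R S p₀ θ)⁻¹) f =
      unitaryOpPi (dualPairι k) (rotBoostOp R S p₀ q₀ θ t (unitaryOpPi (dualPairι k)⁻¹ f)) := by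
  rw [weilDatum_apply_κ_conj_hypV R S p₀ q₀ hW, map_mul, _root_.mul_inv_rev, unitaryOpPi_mul, unitaryOpPi_mul]
  rfl

/-- **slope of `ω` along the partner**: `⟶ μ₀(ι k) (rotBoostGen θ (μ₀(ι k)⁻¹ f))`. [cite: Folland1989, (4.24)] -/
theorem weilDatum_tendsto_κ_mul_phaseP_conj_hypV_sub_div_ofReal
    {ω : Representation ℂ (Ginf P Q R S) (SR (DPIdx P Q R S))}
    (hW : IsArchWeilDatum (ι𝕎 P Q R S) ω) (k : DPK P Q R S) (θ : ℝ) (f : SR (DPIdx P Q R S)) :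
    Tendsto (fun t : ℝ => ((t : ℝ) : ℂ)⁻¹ •
        (ω (κ P Q R S (k * phaseP R S p₀ θ) * (((hypV p₀ q₀ t : UForm P Q), (1 : UForm R S)) : Ginf P Q R S) *
          κ P Q R S (k * phaseP R S p₀ θ)⁻¹) f - f))
      (𝓝[≠] 0) (𝓝 (unitaryOpPi (dualPairι k) (rotBoostGen R S p₀ q₀ θ (unitaryOpPi (dualPairι k)⁻¹ f)))) := by
  have hf : unitaryOpPi (dualPairι k) (unitaryOpPi (dualPairι k)⁻¹ f) = f := unitaryOpPi_mul_inv_apply _ f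
  have h := ((unitaryOpPi (dualPairι k)).continuous.tendsto
    (rotBoostGen R S p₀ q₀ θ (unitaryOpPi (dualPairι k)⁻¹ f))).comp
      (tendsto_rotBoostOp_sub_div_ofReal R S p₀ q₀ θ (unitaryOpPi (dualPairι k)⁻¹ f))
  refine h.congr fun t => ?_
  simp only [Function.comp_apply, map_smul, map_sub, hf, weilDatum_apply_κ_mul_phaseP_conj_hypV R S p₀ q₀ hW]

/-- the partner slope with the time rescaled by `c`. [cite: Folland1989, (4.24)] -/
theorem weilDatum_tendsto_κ_mul_phaseP_conj_hypV_mul_sub_div_ofReal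
    {ω : Representation ℂ (Ginf P Q R S) (SR (DPIdx P Q R S))}
    (hW : IsArchWeilDatum (ι𝕎 P Q R S) ω) (k : DPK P Q R S) (θ c : ℝ) (f : SR (DPIdx P Q R S)) :
    Tendsto (fun t : ℝ => ((t : ℝ) : ℂ)⁻¹ •
        (ω (κ P Q R S (k * phaseP R S p₀ θ) * (((hypV p₀ q₀ (c * t) : UForm P Q), (1 : UForm R S)) : Ginf P Q R S) *
          κ P Q R S (k * phaseP R S p₀ θ)⁻¹) f - f))
      (𝓝[≠] 0)
      (𝓝 (((c : ℝ) : ℂ) • unitaryOpPi (dualPairι k) (rotBoostGen R S p₀ q₀ θ (unitaryOpPi (dualPairι k)⁻¹ f)))) :=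
  tendsto_inv_smul_sub_comp_mul
    (γ := fun s : ℝ => ω (κ P Q R S (k * phaseP R S p₀ θ) *
      (((hypV p₀ q₀ s : UForm P Q), (1 : UForm R S)) : Ginf P Q R S) * κ P Q R S (k * phaseP R S p₀ θ)⁻¹) f)
    (weilDatum_tendsto_κ_mul_phaseP_conj_hypV_sub_div_ofReal R S p₀ q₀ hW k θ f)
    (apply_κ_conj_hypV_zero R S p₀ q₀ ω _ f) c

/-- **THE `𝔭⁻`-ANNIHILATION ALONG EVERY `K`-CONJUGATE**: if `g = μ₀(ι k)⁻¹ f` satisfies `hypOpGen g + i · rotBoostGen (π/2) g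
= 0`, then the two slopes of `ω` at `f` — along `κ k (a_t,1) κ k⁻¹` and along `κ (k k_P(π/2)) (a_t,1) κ (k k_P(π/2))⁻¹` —
exist in `𝓢` and satisfy `D₁ f + i D₂ f = 0`. [cite: Folland1989, Prop (4.39)] -/
theorem weilDatum_pMinus_κ_conj {ω : Representation ℂ (Ginf P Q R S) (SR (DPIdx P Q R S))}
    (hW : IsArchWeilDatum (ι𝕎 P Q R S) ω) (k : DPK P Q R S) (f : SR (DPIdx P Q R S))
    (hf : hypOpGen R S p₀ q₀ (unitaryOpPi (dualPairι k)⁻¹ f) +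
      I • rotBoostGen R S p₀ q₀ (π / 2) (unitaryOpPi (dualPairι k)⁻¹ f) = 0) :
    Tendsto (fun t : ℝ => ((t : ℝ) : ℂ)⁻¹ •
        (ω (κ P Q R S k * (((hypV p₀ q₀ t : UForm P Q), (1 : UForm R S)) : Ginf P Q R S) * κ P Q R S k⁻¹) f - f))
      (𝓝[≠] 0) (𝓝 (unitaryOpPi (dualPairι k) (hypOpGen R S p₀ q₀ (unitaryOpPi (dualPairι k)⁻¹ f)))) ∧
    Tendsto (fun t : ℝ => ((t : ℝ) : ℂ)⁻¹ •
        (ω (κ P Q R S (k * phaseP R S p₀ (π / 2)) * (((hypV p₀ q₀ t : UForm P Q), (1 : UForm R S)) : Ginf P Q R S) *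
          κ P Q R S (k * phaseP R S p₀ (π / 2))⁻¹) f - f))
      (𝓝[≠] 0) (𝓝 (unitaryOpPi (dualPairι k) (rotBoostGen R S p₀ q₀ (π / 2) (unitaryOpPi (dualPairι k)⁻¹ f)))) ∧
    unitaryOpPi (dualPairι k) (hypOpGen R S p₀ q₀ (unitaryOpPi (dualPairι k)⁻¹ f)) +
      I • unitaryOpPi (dualPairι k) (rotBoostGen R S p₀ q₀ (π / 2) (unitaryOpPi (dualPairι k)⁻¹ f)) = 0 :=
  ⟨weilDatum_tendsto_κ_conj_hypV_sub_div_ofReal R S p₀ q₀ hW k f,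
    weilDatum_tendsto_κ_mul_phaseP_conj_hypV_sub_div_ofReal R S p₀ q₀ hW k _ f,
    by rw [← map_smul, ← map_add, hf, map_zero]⟩

/-- … in particular on every degree-one vector (`S = ∅`; `μ₀(ι k)⁻¹ (degOne a) = degOne (…)` is again of degree one).
[cite: Folland1989, Prop (4.39)] -/
theorem weilDatum_pMinus_κ_conj_degOne [IsEmpty S] {ω : Representation ℂ (Ginf P Q R S) (SR (DPIdx P Q R S))}
    (hW : IsArchWeilDatum (ι𝕎 P Q R S) ω) (k : DPK P Q R S) (a : DPIdx P Q R S → ℂ) :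
    Tendsto (fun t : ℝ => ((t : ℝ) : ℂ)⁻¹ •
        (ω (κ P Q R S k * (((hypV p₀ q₀ t : UForm P Q), (1 : UForm R S)) : Ginf P Q R S) * κ P Q R S k⁻¹) (degOne a) -
          degOne a))
      (𝓝[≠] 0) (𝓝 (unitaryOpPi (dualPairι k) (hypOpGen R S p₀ q₀ (unitaryOpPi (dualPairι k)⁻¹ (degOne a))))) ∧
    Tendsto (fun t : ℝ => ((t : ℝ) : ℂ)⁻¹ •
        (ω (κ P Q R S (k * phaseP R S p₀ (π / 2)) * (((hypV p₀ q₀ t : UForm P Q), (1 : UForm R S)) : Ginf P Q R S) *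
          κ P Q R S (k * phaseP R S p₀ (π / 2))⁻¹) (degOne a) - degOne a))
      (𝓝[≠] 0)
      (𝓝 (unitaryOpPi (dualPairι k) (rotBoostGen R S p₀ q₀ (π / 2) (unitaryOpPi (dualPairι k)⁻¹ (degOne a))))) ∧
    unitaryOpPi (dualPairι k) (hypOpGen R S p₀ q₀ (unitaryOpPi (dualPairι k)⁻¹ (degOne a))) +
      I • unitaryOpPi (dualPairι k) (rotBoostGen R S p₀ q₀ (π / 2) (unitaryOpPi (dualPairι k)⁻¹ (degOne a))) = 0 :=
  weilDatum_pMinus_κ_conj R S p₀ q₀ hW k (degOne a)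
    (by rw [unitaryOpPi_degOne]; exact hypOpGen_add_I_smul_rotBoostGen_degOne R S p₀ q₀ _)

/-- … and on the vacuum (`S = ∅`; `μ₀(ι k)⁻¹ h_0 = h_0`). [cite: Folland1989, Prop (4.39)] -/
theorem weilDatum_pMinus_κ_conj_hermitePi_zero [IsEmpty S] {ω : Representation ℂ (Ginf P Q R S) (SR (DPIdx P Q R S))}
    (hW : IsArchWeilDatum (ι𝕎 P Q R S) ω) (k : DPK P Q R S) :
    Tendsto (fun t : ℝ => ((t : ℝ) : ℂ)⁻¹ •
        (ω (κ P Q R S k * (((hypV p₀ q₀ t : UForm P Q), (1 : UForm R S)) : Ginf P Q R S) * κ P Q R S k⁻¹)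
          (hermitePi 0) - hermitePi 0))
      (𝓝[≠] 0) (𝓝 (unitaryOpPi (dualPairι k) (hypOpGen R S p₀ q₀ (hermitePi 0)))) ∧
    Tendsto (fun t : ℝ => ((t : ℝ) : ℂ)⁻¹ •
        (ω (κ P Q R S (k * phaseP R S p₀ (π / 2)) * (((hypV p₀ q₀ t : UForm P Q), (1 : UForm R S)) : Ginf P Q R S) *
          κ P Q R S (k * phaseP R S p₀ (π / 2))⁻¹) (hermitePi 0) - hermitePi 0))
      (𝓝[≠] 0) (𝓝 (unitaryOpPi (dualPairι k) (rotBoostGen R S p₀ q₀ (π / 2) (hermitePi 0)))) ∧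
    unitaryOpPi (dualPairι k) (hypOpGen R S p₀ q₀ (hermitePi 0 : SR (DPIdx P Q R S))) +
      I • unitaryOpPi (dualPairι k) (rotBoostGen R S p₀ q₀ (π / 2) (hermitePi 0)) = 0 := by
  have h := weilDatum_pMinus_κ_conj R S p₀ q₀ hW k (hermitePi 0)
    (by rw [unitaryOpPi_hermitePi_zero]; exact hypOpGen_add_I_smul_rotBoostGen_hermitePi_zero R S p₀ q₀)
  rwa [unitaryOpPi_hermitePi_zero] at h

/-- **THE CONSUMER'S SHAPE** (real difference quotients, speed `c`): if `g = μ₀(ι k)⁻¹ f` satisfies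
`hypOpGen g + i · rotBoostGen (π/2) g = 0` then, with `D₁ f = lim t⁻¹ (ω (κ k (a_{ct},1) κ k⁻¹) f − f)` and
`D₂ f = lim t⁻¹ (ω (κ (k k_P(π/2)) (a_{ct},1) κ (k k_P(π/2))⁻¹) f − f)` (limits in `𝓢` along `𝓝[≠] 0`), both limits exist
and `D₁ f + i D₂ f = 0`. [cite: Folland1989, Prop (4.39); (4.24)] -/
theorem weilDatum_pMinus_κ_conj_smul {ω : Representation ℂ (Ginf P Q R S) (SR (DPIdx P Q R S))}
    (hW : IsArchWeilDatum (ι𝕎 P Q R S) ω) (k : DPK P Q R S) (c : ℝ) (f : SR (DPIdx P Q R S))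
    (hf : hypOpGen R S p₀ q₀ (unitaryOpPi (dualPairι k)⁻¹ f) +
      I • rotBoostGen R S p₀ q₀ (π / 2) (unitaryOpPi (dualPairι k)⁻¹ f) = 0) :
    Tendsto (fun t : ℝ => t⁻¹ •
        (ω (κ P Q R S k * (((hypV p₀ q₀ (c * t) : UForm P Q), (1 : UForm R S)) : Ginf P Q R S) * κ P Q R S k⁻¹) f -
          f))
      (𝓝[≠] 0) (𝓝 (((c : ℝ) : ℂ) • unitaryOpPi (dualPairι k) (hypOpGen R S p₀ q₀ (unitaryOpPi (dualPairι k)⁻¹ f)))) ∧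
    Tendsto (fun t : ℝ => t⁻¹ •
        (ω (κ P Q R S (k * phaseP R S p₀ (π / 2)) *
            (((hypV p₀ q₀ (c * t) : UForm P Q), (1 : UForm R S)) : Ginf P Q R S) *
          κ P Q R S (k * phaseP R S p₀ (π / 2))⁻¹) f - f))
      (𝓝[≠] 0)
      (𝓝 (((c : ℝ) : ℂ) •
        unitaryOpPi (dualPairι k) (rotBoostGen R S p₀ q₀ (π / 2) (unitaryOpPi (dualPairι k)⁻¹ f)))) ∧
    ((c : ℝ) : ℂ) • unitaryOpPi (dualPairι k) (hypOpGen R S p₀ q₀ (unitaryOpPi (dualPairι k)⁻¹ f)) +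
      I • (((c : ℝ) : ℂ) •
        unitaryOpPi (dualPairι k) (rotBoostGen R S p₀ q₀ (π / 2) (unitaryOpPi (dualPairι k)⁻¹ f))) = 0 := by
  refine ⟨tendsto_ofReal_inv_smul_iff.1 (weilDatum_tendsto_κ_conj_hypV_mul_sub_div_ofReal R S p₀ q₀ hW k c f),
    tendsto_ofReal_inv_smul_iff.1
      (weilDatum_tendsto_κ_mul_phaseP_conj_hypV_mul_sub_div_ofReal R S p₀ q₀ hW k _ c f), ?_⟩
  rw [smul_comm I, ← smul_add, (weilDatum_pMinus_κ_conj R S p₀ q₀ hW k f hf).2.2, smul_zero]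

/-- the consumer's shape on every degree-one vector (`S = ∅`). [cite: Folland1989, Prop (4.39)] -/
theorem weilDatum_pMinus_κ_conj_smul_degOne [IsEmpty S] {ω : Representation ℂ (Ginf P Q R S) (SR (DPIdx P Q R S))}
    (hW : IsArchWeilDatum (ι𝕎 P Q R S) ω) (k : DPK P Q R S) (c : ℝ) (a : DPIdx P Q R S → ℂ) :
    Tendsto (fun t : ℝ => t⁻¹ •
        (ω (κ P Q R S k * (((hypV p₀ q₀ (c * t) : UForm P Q), (1 : UForm R S)) : Ginf P Q R S) * κ P Q R S k⁻¹)
          (degOne a) - degOne a))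
      (𝓝[≠] 0)
      (𝓝 (((c : ℝ) : ℂ) •
        unitaryOpPi (dualPairι k) (hypOpGen R S p₀ q₀ (unitaryOpPi (dualPairι k)⁻¹ (degOne a))))) ∧
    Tendsto (fun t : ℝ => t⁻¹ •
        (ω (κ P Q R S (k * phaseP R S p₀ (π / 2)) *
            (((hypV p₀ q₀ (c * t) : UForm P Q), (1 : UForm R S)) : Ginf P Q R S) *
          κ P Q R S (k * phaseP R S p₀ (π / 2))⁻¹) (degOne a) - degOne a))
      (𝓝[≠] 0)
      (𝓝 (((c : ℝ) : ℂ) •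
        unitaryOpPi (dualPairι k) (rotBoostGen R S p₀ q₀ (π / 2) (unitaryOpPi (dualPairι k)⁻¹ (degOne a))))) ∧
    ((c : ℝ) : ℂ) • unitaryOpPi (dualPairι k) (hypOpGen R S p₀ q₀ (unitaryOpPi (dualPairι k)⁻¹ (degOne a))) +
      I • (((c : ℝ) : ℂ) •
        unitaryOpPi (dualPairι k) (rotBoostGen R S p₀ q₀ (π / 2) (unitaryOpPi (dualPairι k)⁻¹ (degOne a)))) = 0 :=
  weilDatum_pMinus_κ_conj_smul R S p₀ q₀ hW k c (degOne a)
    (by rw [unitaryOpPi_degOne]; exact hypOpGen_add_I_smul_rotBoostGen_degOne R S p₀ q₀ _)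

/-- the consumer's shape on the vacuum (`S = ∅`). [cite: Folland1989, Prop (4.39)] -/
theorem weilDatum_pMinus_κ_conj_smul_hermitePi_zero [IsEmpty S]
    {ω : Representation ℂ (Ginf P Q R S) (SR (DPIdx P Q R S))}
    (hW : IsArchWeilDatum (ι𝕎 P Q R S) ω) (k : DPK P Q R S) (c : ℝ) :
    Tendsto (fun t : ℝ => t⁻¹ •
        (ω (κ P Q R S k * (((hypV p₀ q₀ (c * t) : UForm P Q), (1 : UForm R S)) : Ginf P Q R S) * κ P Q R S k⁻¹)
          (hermitePi 0) - hermitePi 0))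
      (𝓝[≠] 0) (𝓝 (((c : ℝ) : ℂ) • unitaryOpPi (dualPairι k) (hypOpGen R S p₀ q₀ (hermitePi 0)))) ∧
    Tendsto (fun t : ℝ => t⁻¹ •
        (ω (κ P Q R S (k * phaseP R S p₀ (π / 2)) *
            (((hypV p₀ q₀ (c * t) : UForm P Q), (1 : UForm R S)) : Ginf P Q R S) *
          κ P Q R S (k * phaseP R S p₀ (π / 2))⁻¹) (hermitePi 0) - hermitePi 0))
      (𝓝[≠] 0) (𝓝 (((c : ℝ) : ℂ) • unitaryOpPi (dualPairι k) (rotBoostGen R S p₀ q₀ (π / 2) (hermitePi 0)))) ∧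
    ((c : ℝ) : ℂ) • unitaryOpPi (dualPairι k) (hypOpGen R S p₀ q₀ (hermitePi 0 : SR (DPIdx P Q R S))) +
      I • (((c : ℝ) : ℂ) • unitaryOpPi (dualPairι k) (rotBoostGen R S p₀ q₀ (π / 2) (hermitePi 0))) = 0 := by
  have h := weilDatum_pMinus_κ_conj_smul R S p₀ q₀ hW k c (hermitePi 0)
    (by rw [unitaryOpPi_hermitePi_zero]; exact hypOpGen_add_I_smul_rotBoostGen_hermitePi_zero R S p₀ q₀)
  rwa [unitaryOpPi_hermitePi_zero] at h

end Weil

end RealDualPair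

end Literature.RepresentationTheory.KonnoKonno2007

end
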